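/-
Copyright: statement-level skeleton of a published paper (lit-balaban cell, reader/typer r15). No proof claims beyond
what the kernel checks below.
-/
import Literature.MathematicalPhysics.QuantumFieldTheory.BalabanImbrieJaffe1984to88.BIJ85Eq7120

/-!
# BIJ85 — T. Bałaban, J. Imbrie, A. Jaffe, *Renormalization of the Higgs model: minimizers, propagators and the stability
of mean field theory*, CMP **97** (1985) 299–329 [BalabanImbrieJaffe1985], Sect. 7.1 pp. 321–322: the momentum-space
symbols (7.1.3)–(7.1.11) used in the proof of Theorem 7.1.1

statement-level skeleton of published theorems with citation tags; proofs where landed; nothing here is a claim about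
the Yang–Mills mass gap

Source: held text `paper:balaban1985-cmp97-bij-higgs-minimizers` (journal page = PDF page + 298); renders of pp. 321–322
read as images (`run/shared/lean/pub/pub-balaban/t4/b2b-balaban-t4-lit2/renders/bij1985/…-p023,p024-x2.png`).  Row
**C1.Eq7.1.2-7.1.12** of `HOME/lit-balaban-r15/ROWS-C1.md` (reader/typer r15, fold owner of C1); sibling of `BIJ85Eq7120`
((7.1.20), whose `vAbs` is the printed modulus |v_μ(p)| — linked here by `norm_vSym`) and `BIJ85Sect7Statements` (Thm 7.1.1).

THE PRINTED TEXT (verbatim).  p. 321 [PDF 23]: *"Since we study periodic boundary conditions, σ_k is translation invariant.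
Thus it is natural to study σ_k as a multiplication operator σ_k(p) in the Fourier transform representation. … The momenta p
have d components p_i, and |p_i| ≤ π. We introduce a tensor notation with functions f_{μν} on plaquettes given as antisymmetric
functions on coordinate axes μ, ν … Then ⟨f^{(k)}, σ_kf^{(k)}⟩ = ∫_{−π}^{π}…∫_{−π}^{π} ⟨f̃^{(k)}(p), σ_k(p)f̃^{(k)}(p)⟩dp, (7.1.2)
where the momentum p inner product is defined by ⟨f̃(p), σ_k(p)f̃(p)⟩ = Σ_{μ,ν,λ,κ} \bar{f̃}_{μν}(p)σ_{k;μνλκ}(p)f̃_{λκ}(p). (7.1.3)"*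
p. 322 [PDF 24]: *"|p_i| ≤ π/η = πL^k … We use a superscript (1) to denote the unit lattice scale. With these conventions, the
derivative ∂ can be represented by a diagonal d × d matrix ∂(p) with eigenvalues ∂_μ(p) = (exp(iηp_μ) − 1)/η. (7.1.4) The unit
lattice derivative ∂^{(1)}(p) is a similar matrix with eigenvalues ∂^{(1)}_μ(p) = exp(ip_μ) − 1. (7.1.5) The corresponding
Laplacians are Δ(p) = Tr ∂(p)^*∂(p), Δ^{(1)}(p) = Tr ∂^{(1)}(p)^*∂^{(1)}(p). (7.1.6) We require the operator V(p) defined by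
V(p) = ∂^{(1)}(p′)∂(p)^{−1}. (7.1.7) Here and below we use the notation p′_i ∈ [−π, π] and p′ = p mod 2π, (7.1.8) so p′ denotes
a unit lattice momentum. The eigenvalues of V(p) are v_μ(p) = ∂^{(1)}_μ(p′)/∂_μ(p). In terms of V(p) we also define
u(p) = det V(p) (7.1.9) and φ_μ(p′) = Σ_{l∈2πZ^d, |l_i|≤π/η} |u(p′+l)v_μ(p′+l)|²Δ(p′+l)^{−1}. (7.1.10) In terms of these
functions we can express the averaging operators Q^e_k, etc. For example (Q^e_kf)~_{μν}(p′) = Σ_l u(p′+l)f̃_{μν}(p′+l)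
(v_μ(p′+l)v_ν(p′+l))^{−1}. (7.1.11) The basic object we wish to study is σ_k, defined in (4.2.2), σ_k = Q^e_k(I − ∂G_{k,Ax}∂^*)
Q^{e*}_k. (7.1.12)"*

WHAT IS TYPED (defs with bodies) / PROVED.  (7.1.3) `tensorInner`; (7.1.4) `dSym`, (7.1.5) `dOne` (`dSym_one`: ∂ at η = 1 is
∂^{(1)}), with the moduli PROVED: |∂^{(1)}_μ(p)| = 2|sin(p_μ/2)| (`norm_dOne`), |∂_μ(p)| = 2|sin(ηp_μ/2)|/η (`norm_dSym`);
(7.1.6) `lapSym`/`lapOne` as Σ_μ|∂_μ(p)|², PROVED equal to the printed trace Tr ∂(p)^*∂(p) of the diagonal matrix `dMat`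
(`trace_dMat`) and to Σ_μ(2 − 2cos p_μ) at η = 1 (`lapOne_eq`); (7.1.8) `wrap` (p′ = p mod 2π, componentwise in (−π, π] via
Mathlib's `toIocMod`; `wrap_mem`, and the 2π-periodicity `dOne_wrap`); (7.1.7) `vSym` (v_μ(p) = ∂^{(1)}_μ(p′)/∂_μ(p),
`vSym_eq` without the wrap), `VMat` (V(p) diagonal); (7.1.9) `uSym` = det V(p), PROVED = Π_μ v_μ(p) (`uSym_eq_prod`); the
p. 323 modulus formula *"|v_μ(p)| = [sin(p_μ/2)/(p_μ/2)]·[(p_μη/2)/sin(p_μη/2)]"* PROVED as the bridge `norm_vSym` to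
`BIJ85Eq7120.vAbs` (0 < |p_μ| ≤ π, 0 < η ≤ 1); (7.1.10) `phiSym` and (7.1.11) `QeSym` as finite sums over l = 2πm,
m ∈ ℤ^d with |m_i| ≤ M (T-note: the printed range |l_i| ≤ π/η is |m_i| ≤ L^k/2; the bound M is a parameter).
NOT TYPED: (7.1.2) (the Plancherel identity for the plaquette-field pairing — the Fourier machinery of the series is
`…Balaban1983to89.B5Prop11Plancherel`; row only) and (7.1.12) (= (4.2.2), typed as `BIJ85Sect4Statements.GaugeRG` data /
hypothesis `h422` of `BIJ85Eq427Proof`).  NOTHING beyond the kernel-checked statements below is asserted.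

v1.1 (append-only, r15 gen 2; row C1.Eq7.1.13-7.1.19): (7.1.13)–(7.1.18) pp. 322–323 — `projSym` (the bracket
[δ_{μλ} − ∂_μ\bar{∂}_λ/Δ] of (7.1.14), PROVED Hermitian `projSym_conj`, killing ∂(p) `projSym_dSym` and idempotent `projSym_idem`:
"the expressions inside brackets [ ] are projection operators"), `tau1Term`/`tau1Sym` ((7.1.14)), `aSym` ((7.1.16)), `tau2Sym`
((7.1.15)), `Eq7113` ((7.1.13) σ_k = τ₁ + τ₂ as a named statement about the symbol of σ_k — its derivation from [6 I] is not
reproduced), `curlOne` (unit-lattice curl components), and PROVED: "τ₁ vanishes on curls … if f = ∂B, then τ₁f = 0" at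
generic momenta (`curlOne_div_vSym` = the momentum form of Q^{e*}_k∂ = ∂Q^{s*}_k, `tau1Term_curl`, `tau1Sym_curl`) and the
operator statement (7.1.17)–(7.1.18) (`eq7118`).  (7.1.19) (the decomposition 𝒦 = ∂ℋ ⊕ (∂ℋ)^⊥ for the inner product
(7.1.19b)) is not typed here.
-/

open scoped BigOperators ComplexConjugate

namespace Literature.MathematicalPhysics.QuantumFieldTheory.BalabanImbrieJaffe1984to88.BIJ85MomentumSymbols71

open Real BIJ85Eq7120

noncomputable section

variable {d : ℕ}

/-! ## (7.1.3): the momentum-p tensor inner product -/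

/-- **(7.1.3)** p. 321 [PDF 23], verbatim: *"⟨f̃(p), σ_k(p)f̃(p)⟩ = Σ_{μ,ν,λ,κ} \bar{f̃}_{μν}(p)σ_{k;μνλκ}(p)f̃_{λκ}(p). (7.1.3)"*
— at a fixed momentum: `f`, `g` the tensor components f̃_{μν}(p) (antisymmetric in the paper; not imposed), `σ` the
components σ_{k;μνλκ}(p). [cite: BalabanImbrieJaffe1985, (7.1.3) p.321] -/
def tensorInner (f : Fin d → Fin d → ℂ) (σ : Fin d → Fin d → Fin d → Fin d → ℂ) (g : Fin d → Fin d → ℂ) : ℂ :=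
  ∑ μ : Fin d, ∑ ν : Fin d, ∑ l : Fin d, ∑ κ : Fin d, conj (f μ ν) * σ μ ν l κ * g l κ

/-! ## (7.1.4)–(7.1.6): lattice derivatives and Laplacians in momentum space -/

/-- **(7.1.4)** p. 322 [PDF 24], verbatim: *"the derivative ∂ can be represented by a diagonal d × d matrix ∂(p) with
eigenvalues ∂_μ(p) = (exp(iηp_μ) − 1)/η. (7.1.4)"* (η = L^{−k} the fine lattice spacing). [cite: BalabanImbrieJaffe1985, (7.1.4) p.322] -/
def dSym (η : ℝ) (p : Fin d → ℝ) (μ : Fin d) : ℂ :=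
  (Complex.exp (Complex.I * ((η * p μ : ℝ) : ℂ)) - 1) / (η : ℂ)

/-- **(7.1.5)** p. 322 [PDF 24], verbatim: *"The unit lattice derivative ∂^{(1)}(p) is a similar matrix with eigenvalues
∂^{(1)}_μ(p) = exp(ip_μ) − 1. (7.1.5)"* [cite: BalabanImbrieJaffe1985, (7.1.5) p.322] -/
def dOne (p : Fin d → ℝ) (μ : Fin d) : ℂ :=
  Complex.exp (Complex.I * ((p μ : ℝ) : ℂ)) - 1

/-- kernel: ∂^{(1)} is ∂ at η = 1 ("superscript (1) to denote the unit lattice scale"). [cite: BalabanImbrieJaffe1985, (7.1.5) p.322] -/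
theorem dSym_one (p : Fin d → ℝ) (μ : Fin d) : dSym 1 p μ = dOne p μ := by
  simp [dSym, dOne]

/-- kernel: |∂^{(1)}_μ(p)| = 2|sin(p_μ/2)|. [cite: BalabanImbrieJaffe1985, (7.1.5) p.322] -/
theorem norm_dOne (p : Fin d → ℝ) (μ : Fin d) : ‖dOne p μ‖ = 2 * |Real.sin (p μ / 2)| := by
  rw [dOne, Complex.norm_exp_I_mul_ofReal_sub_one, Real.norm_eq_abs, abs_mul, abs_two]

/-- kernel: |∂_μ(p)| = 2|sin(ηp_μ/2)|/η for η > 0. [cite: BalabanImbrieJaffe1985, (7.1.4) p.322] -/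
theorem norm_dSym {η : ℝ} (hη : 0 < η) (p : Fin d → ℝ) (μ : Fin d) :
    ‖dSym η p μ‖ = 2 * |Real.sin (η * p μ / 2)| / η := by
  rw [dSym, norm_div, Complex.norm_exp_I_mul_ofReal_sub_one, Complex.norm_real, Real.norm_eq_abs, Real.norm_eq_abs,
    abs_mul, abs_two, abs_of_pos hη]

/-- ∂(p) as the printed diagonal d × d matrix. [cite: BalabanImbrieJaffe1985, (7.1.4) p.322] -/
def dMat (η : ℝ) (p : Fin d → ℝ) : Matrix (Fin d) (Fin d) ℂ := Matrix.diagonal (dSym η p)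

/-- **(7.1.6)** p. 322 [PDF 24], verbatim: *"The corresponding Laplacians are Δ(p) = Tr ∂(p)^*∂(p), Δ^{(1)}(p) =
Tr ∂^{(1)}(p)^*∂^{(1)}(p). (7.1.6)"* — typed as the real number Σ_μ|∂_μ(p)|² (= the printed trace: `trace_dMat`).
[cite: BalabanImbrieJaffe1985, (7.1.6) p.322] -/
def lapSym (η : ℝ) (p : Fin d → ℝ) : ℝ := ∑ μ : Fin d, ‖dSym η p μ‖ ^ 2

/-- **(7.1.6)**, unit lattice: Δ^{(1)}(p) = Σ_μ|∂^{(1)}_μ(p)|². [cite: BalabanImbrieJaffe1985, (7.1.6) p.322] -/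
def lapOne (p : Fin d → ℝ) : ℝ := ∑ μ : Fin d, ‖dOne p μ‖ ^ 2

/-- kernel: the printed trace Tr ∂(p)^*∂(p) of the diagonal matrix IS Σ_μ|∂_μ(p)|². [cite: BalabanImbrieJaffe1985, (7.1.6) p.322] -/
theorem trace_dMat (η : ℝ) (p : Fin d → ℝ) :
    Matrix.trace ((dMat η p).conjTranspose * dMat η p) = (lapSym η p : ℂ) := by
  rw [dMat, Matrix.diagonal_conjTranspose, Matrix.diagonal_mul_diagonal, Matrix.trace_diagonal, lapSym]
  push_cast
  refine Finset.sum_congr rfl fun μ _ => ?_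
  rw [Pi.star_apply, Complex.star_def, Complex.conj_mul']

/-- kernel: Δ^{(1)}(p) = Δ(p) at η = 1. [cite: BalabanImbrieJaffe1985, (7.1.6) p.322] -/
theorem lapSym_one (p : Fin d → ℝ) : lapSym 1 p = lapOne p := by
  simp [lapSym, lapOne, dSym_one]

/-- kernel: Δ^{(1)}(p) = Σ_μ(2 − 2cos p_μ) (= Σ_μ 4sin²(p_μ/2)). [cite: BalabanImbrieJaffe1985, (7.1.6) p.322] -/
theorem lapOne_eq (p : Fin d → ℝ) : lapOne p = ∑ μ : Fin d, (2 - 2 * Real.cos (p μ)) := by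
  refine Finset.sum_congr rfl fun μ _ => ?_
  rw [norm_dOne, mul_pow, sq_abs, Real.sin_sq_eq_half_sub, show (2 : ℝ) * (p μ / 2) = p μ by ring]
  ring

/-! ## (7.1.7)–(7.1.9): p′ = p mod 2π, V(p), v_μ(p), u(p) -/

/-- **(7.1.8)** p. 322 [PDF 24], verbatim: *"Here and below we use the notation p′_i ∈ [−π, π] and p′ = p mod 2π, (7.1.8) so
p′ denotes a unit lattice momentum."* — componentwise reduction into (−π, π] (Mathlib `toIocMod`; the endpoint convention is
immaterial for the 2π-periodic symbols, `dOne_wrap`). [cite: BalabanImbrieJaffe1985, (7.1.8) p.322] -/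
def wrap (p : Fin d → ℝ) : Fin d → ℝ := fun i => toIocMod Real.two_pi_pos (-π) (p i)

/-- kernel: p′_i ∈ (−π, π]. [cite: BalabanImbrieJaffe1985, (7.1.8) p.322] -/
theorem wrap_mem (p : Fin d → ℝ) (i : Fin d) : wrap p i ∈ Set.Ioc (-π) π := by
  have h := toIocMod_mem_Ioc Real.two_pi_pos (-π) (p i)
  rw [show -π + 2 * π = π by ring] at h
  exact h

/-- kernel: p′ − p ∈ 2πℤ^d componentwise. [cite: BalabanImbrieJaffe1985, (7.1.8) p.322] -/
theorem wrap_eq_sub (p : Fin d → ℝ) (i : Fin d) :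
    wrap p i = p i - (toIocDiv Real.two_pi_pos (-π) (p i) : ℝ) * (2 * π) := by
  rw [wrap, toIocMod, zsmul_eq_mul]

/-- kernel: ∂^{(1)} is 2π-periodic, so ∂^{(1)}_μ(p′) = ∂^{(1)}_μ(p). [cite: BalabanImbrieJaffe1985, (7.1.8) p.322] -/
theorem dOne_wrap (p : Fin d → ℝ) (μ : Fin d) : dOne (wrap p) μ = dOne p μ := by
  rw [dOne, dOne, wrap_eq_sub]
  congr 1
  set n : ℤ := toIocDiv Real.two_pi_pos (-π) (p μ)
  have h : Complex.I * (((p μ - (n : ℝ) * (2 * π) : ℝ)) : ℂ) = Complex.I * ((p μ : ℝ) : ℂ) + (-n : ℤ) * (2 * π * Complex.I) := by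
    push_cast
    ring
  rw [h, Complex.exp_add, Complex.exp_int_mul_two_pi_mul_I, mul_one]

/-- **(7.1.7)** p. 322 [PDF 24]: *"We require the operator V(p) defined by V(p) = ∂^{(1)}(p′)∂(p)^{−1}. (7.1.7) … The
eigenvalues of V(p) are v_μ(p) = ∂^{(1)}_μ(p′)/∂_μ(p)."* — the eigenvalues. [cite: BalabanImbrieJaffe1985, (7.1.7) p.322] -/
def vSym (η : ℝ) (p : Fin d → ℝ) (μ : Fin d) : ℂ := dOne (wrap p) μ / dSym η p μ

/-- kernel: v_μ(p) = ∂^{(1)}_μ(p)/∂_μ(p) (the reduction p ↦ p′ does not change ∂^{(1)}). [cite: BalabanImbrieJaffe1985, (7.1.7) p.322] -/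
theorem vSym_eq (η : ℝ) (p : Fin d → ℝ) (μ : Fin d) : vSym η p μ = dOne p μ / dSym η p μ := by
  rw [vSym, dOne_wrap]

/-- **(7.1.7)**: V(p) = ∂^{(1)}(p′)∂(p)^{−1} as the diagonal matrix of its eigenvalues v_μ(p). [cite: BalabanImbrieJaffe1985, (7.1.7) p.322] -/
def VMat (η : ℝ) (p : Fin d → ℝ) : Matrix (Fin d) (Fin d) ℂ := Matrix.diagonal (vSym η p)

/-- **(7.1.9)** p. 322 [PDF 24], verbatim: *"In terms of V(p) we also define u(p) = det V(p) (7.1.9)"*.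
[cite: BalabanImbrieJaffe1985, (7.1.9) p.322] -/
def uSym (η : ℝ) (p : Fin d → ℝ) : ℂ := (VMat η p).det

/-- kernel: u(p) = Π_μ v_μ(p). [cite: BalabanImbrieJaffe1985, (7.1.9) p.322] -/
theorem uSym_eq_prod (η : ℝ) (p : Fin d → ℝ) : uSym η p = ∏ μ : Fin d, vSym η p μ := by
  rw [uSym, VMat, Matrix.det_diagonal]

/-- kernel, the p. 323 modulus formula: *"In fact |v_μ(p)| = [sin(p_μ/2)/(p_μ/2)]·[(p_μη/2)/sin(p_μη/2)]"* — PROVED: for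
0 < |p_μ| ≤ π and 0 < η ≤ 1, |v_μ(p)| is the quotient `BIJ85Eq7120.vAbs η p_μ` of the two bracketed factors (so (7.1.20)
`BIJ85Eq7120.ineq7120` applies to it). [cite: BalabanImbrieJaffe1985, (7.1.20) p.323] -/
theorem norm_vSym {η : ℝ} (hη0 : 0 < η) (hη1 : η ≤ 1) (p : Fin d → ℝ) (μ : Fin d) (hp0 : p μ ≠ 0) (hp : |p μ| ≤ π) :
    ‖vSym η p μ‖ = vAbs η (p μ) := by
  rw [vSym_eq, norm_div, norm_dOne, norm_dSym hη0]
  -- the two sines have the sign of p_μ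
  have hq : 0 < |p μ| := abs_pos.mpr hp0
  have h1 : |p μ| / 2 < π := by linarith [Real.pi_pos]
  have h2 : η * |p μ| / 2 < π := by nlinarith [Real.pi_pos]
  have hs1 : 0 < Real.sin (|p μ| / 2) := Real.sin_pos_of_pos_of_lt_pi (by positivity) h1
  have hs2 : 0 < Real.sin (η * |p μ| / 2) := Real.sin_pos_of_pos_of_lt_pi (by positivity) h2
  have key : |Real.sin (p μ / 2)| / |Real.sin (η * p μ / 2)| = Real.sin (p μ / 2) / Real.sin (η * p μ / 2) := by
    rcases lt_or_gt_of_ne hp0 with hneg | hpos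
    · rw [abs_of_neg hneg] at hs1 hs2
      have e1 : Real.sin (p μ / 2) = -Real.sin (-p μ / 2) := by rw [← Real.sin_neg]; ring_nf
      have e2 : Real.sin (η * p μ / 2) = -Real.sin (η * -p μ / 2) := by rw [← Real.sin_neg]; ring_nf
      rw [e1, e2, abs_neg, abs_neg, abs_of_pos hs1, abs_of_pos hs2, neg_div_neg_eq]
    · rw [abs_of_pos hpos] at hs1 hs2
      rw [abs_of_pos hs1, abs_of_pos hs2]
  have hsin2 : Real.sin (η * p μ / 2) ≠ 0 := by
    intro h0
    rw [h0, abs_zero] at key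
    rcases lt_or_gt_of_ne hp0 with hneg | hpos
    · rw [abs_of_neg hneg] at hs2
      have : Real.sin (η * p μ / 2) = -Real.sin (η * -p μ / 2) := by rw [← Real.sin_neg]; ring_nf
      rw [this, neg_eq_zero] at h0
      exact hs2.ne' h0
    · rw [abs_of_pos hpos] at hs2
      exact hs2.ne' h0
  unfold vAbs sincR
  field_simp
  rw [show p μ * η / 2 = η * p μ / 2 by ring]
  exact key

/-! ## (7.1.10)–(7.1.11): the sums over l ∈ 2πZ^d -/

/-- The finite index set of (7.1.10): l = 2πm, m ∈ ℤ^d, |m_i| ≤ M (printed: |l_i| ≤ π/η, i.e. |m_i| ≤ L^k/2; the bound `M`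
is a parameter — T-note). [cite: BalabanImbrieJaffe1985, (7.1.10) p.322] -/
def lShifts (d M : ℕ) : Finset (Fin d → ℤ) := Fintype.piFinset fun _ => Finset.Icc (-(M : ℤ)) M

/-- p′ + l for l = 2πm. [cite: BalabanImbrieJaffe1985, (7.1.10) p.322] -/
def shiftMom (p' : Fin d → ℝ) (m : Fin d → ℤ) : Fin d → ℝ := fun i => p' i + 2 * π * (m i : ℝ)

/-- **(7.1.10)** p. 322 [PDF 24], verbatim: *"φ_μ(p′) = Σ_{l∈2πZ^d, |l_i|≤π/η} |u(p′+l)v_μ(p′+l)|²Δ(p′+l)^{−1}. (7.1.10)"*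
[cite: BalabanImbrieJaffe1985, (7.1.10) p.322] -/
def phiSym (η : ℝ) (M : ℕ) (p' : Fin d → ℝ) (μ : Fin d) : ℝ :=
  ∑ m ∈ lShifts d M, ‖uSym η (shiftMom p' m) * vSym η (shiftMom p' m) μ‖ ^ 2 * (lapSym η (shiftMom p' m))⁻¹

/-- **(7.1.11)** p. 322 [PDF 24], verbatim: *"In terms of these functions we can express the averaging operators Q^e_k, etc.
For example (Q^e_kf)~_{μν}(p′) = Σ_l u(p′+l)f̃_{μν}(p′+l)(v_μ(p′+l)v_ν(p′+l))^{−1}. (7.1.11)"* — `ft` = the Fourier components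
f̃_{μν} of the η-lattice plaquette field. [cite: BalabanImbrieJaffe1985, (7.1.11) p.322] -/
def QeSym (η : ℝ) (M : ℕ) (ft : (Fin d → ℝ) → Fin d → Fin d → ℂ) (p' : Fin d → ℝ) (μ ν : Fin d) : ℂ :=
  ∑ m ∈ lShifts d M, uSym η (shiftMom p' m) * ft (shiftMom p' m) μ ν *
    (vSym η (shiftMom p' m) μ * vSym η (shiftMom p' m) ν)⁻¹

/-- kernel: l = 0 belongs to the index set (the "l = 0 term" τ₀ of (7.1.28)). [cite: BalabanImbrieJaffe1985, (7.1.10) p.322] -/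
theorem zero_mem_lShifts (d M : ℕ) : (0 : Fin d → ℤ) ∈ lShifts d M := by
  simp [lShifts, Fintype.mem_piFinset]

/-- kernel: p′ + 0 = p′. [cite: BalabanImbrieJaffe1985, (7.1.10) p.322] -/
theorem shiftMom_zero (p' : Fin d → ℝ) : shiftMom p' 0 = p' := by
  funext i
  simp [shiftMom]

/-! ## v1.1 (append-only): (7.1.13)–(7.1.18) — τ₁, τ₂ and the vanishing of τ₁ on curls (pp. 322–323) -/

/-- The bracket of **(7.1.14)** p. 322: P_{μλ}(p) = δ_{μλ} − ∂_μ(p)\bar{∂_λ(p)}/Δ(p) — *"In both τ₁ and τ₂ the expressions inside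
brackets [ ] are projection operators"* (p. 323): the orthogonal projection of ℂ^d onto ∂(p)^⊥ (`projSym_conj`, `projSym_dSym`,
`projSym_idem`). [cite: BalabanImbrieJaffe1985, (7.1.14) p.322] -/
def projSym (η : ℝ) (p : Fin d → ℝ) (μ l : Fin d) : ℂ :=
  (if μ = l then 1 else 0) - dSym η p μ * conj (dSym η p l) / (lapSym η p : ℂ)

/-- kernel: Δ(p) = Σ_λ \bar{∂_λ(p)}∂_λ(p) as a complex number. [cite: BalabanImbrieJaffe1985, (7.1.6) p.322] -/
theorem lapSym_eq_sum_conj_mul (η : ℝ) (p : Fin d → ℝ) :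
    (lapSym η p : ℂ) = ∑ l : Fin d, conj (dSym η p l) * dSym η p l := by
  rw [lapSym]
  push_cast
  exact Finset.sum_congr rfl fun l _ => (Complex.conj_mul' _).symm

/-- kernel: the bracket is Hermitian, \bar{P_{λκ}} = P_{κλ}. [cite: BalabanImbrieJaffe1985, (7.1.14) p.322] -/
theorem projSym_conj (η : ℝ) (p : Fin d → ℝ) (l κ : Fin d) : conj (projSym η p l κ) = projSym η p κ l := by
  simp only [projSym, map_sub, map_div₀, map_mul, Complex.conj_conj, Complex.conj_ofReal, apply_ite conj, map_one,
    map_zero, eq_comm, mul_comm]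

/-- kernel: the bracket kills ∂(p): Σ_λ P_{μλ}(p)∂_λ(p) = 0 (Δ(p) ≠ 0) — the mechanism of "τ₁ vanishes on curls".
[cite: BalabanImbrieJaffe1985, (7.1.14) p.322] -/
theorem projSym_dSym {η : ℝ} {p : Fin d → ℝ} (hΔ : lapSym η p ≠ 0) (μ : Fin d) :
    ∑ l : Fin d, projSym η p μ l * dSym η p l = 0 := by
  have hΔc : (lapSym η p : ℂ) ≠ 0 := by exact_mod_cast hΔ
  simp only [projSym, sub_mul, Finset.sum_sub_distrib, ite_mul, one_mul, zero_mul, Finset.sum_ite_eq,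
    Finset.mem_univ, if_true]
  rw [sub_eq_zero]
  calc dSym η p μ = dSym η p μ * (lapSym η p : ℂ) / (lapSym η p : ℂ) := by field_simp
    _ = ∑ l : Fin d, dSym η p μ * conj (dSym η p l) / (lapSym η p : ℂ) * dSym η p l := by
        rw [lapSym_eq_sum_conj_mul, Finset.mul_sum, Finset.sum_div]
        exact Finset.sum_congr rfl fun l _ => by ring

/-- kernel: the bracket is idempotent, Σ_λ P_{μλ}P_{λκ} = P_{μκ} (Δ(p) ≠ 0) — with `projSym_conj`: an orthogonal projection.
[cite: BalabanImbrieJaffe1985, (7.1.14) p.322] -/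
theorem projSym_idem {η : ℝ} {p : Fin d → ℝ} (hΔ : lapSym η p ≠ 0) (μ κ : Fin d) :
    ∑ l : Fin d, projSym η p μ l * projSym η p l κ = projSym η p μ κ := by
  -- Σ_λ \bar{∂_λ} P_{λκ} = \bar{Σ_λ P_{κλ}∂_λ} = 0
  have hker : ∑ l : Fin d, conj (dSym η p l) * projSym η p l κ = 0 := by
    have h := congrArg conj (projSym_dSym hΔ κ)
    rw [map_sum, map_zero] at h
    rw [← h]
    exact Finset.sum_congr rfl fun l _ => by rw [map_mul, projSym_conj, mul_comm]
  have hexp : ∀ l : Fin d, projSym η p μ l * projSym η p l κ =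
      (if μ = l then projSym η p l κ else 0) -
        dSym η p μ / (lapSym η p : ℂ) * (conj (dSym η p l) * projSym η p l κ) := by
    intro l
    rw [projSym]
    split_ifs <;> ring
  simp_rw [hexp]
  rw [Finset.sum_sub_distrib, ← Finset.mul_sum, hker, mul_zero, sub_zero, Finset.sum_ite_eq, if_pos (Finset.mem_univ μ)]

/-- **(7.1.14)** p. 322 [PDF 24], verbatim: *"Explicitly τ_{1,μνλκ}(p′) = ½Σ_l (|u|²/(\bar{v}_μ\bar{v}_νv_λv_κ)
[δ_{μλ} − ∂_μ\bar{∂}_λ/Δ][δ_{νκ} − ∂_ν\bar{∂}_κ/Δ])(p′+l), (7.1.14)"* … p. 323: *"In the formula for τ₁(p′), each term on the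
right side is evaluated at momentum p′+l."* — the term at q = p′+l. [cite: BalabanImbrieJaffe1985, (7.1.14) p.322] -/
def tau1Term (η : ℝ) (q : Fin d → ℝ) (μ ν l κ : Fin d) : ℂ :=
  (((‖uSym η q‖ ^ 2 : ℝ) : ℂ) / (conj (vSym η q μ) * conj (vSym η q ν) * vSym η q l * vSym η q κ)) *
    (projSym η q μ l * projSym η q ν κ)

/-- **(7.1.14)**: τ_{1,μνλκ}(p′) = ½Σ_l (…)(p′+l), the sum over l = 2πm ∈ 2πZ^d, |m_i| ≤ M (`lShifts`).
[cite: BalabanImbrieJaffe1985, (7.1.14) p.322] -/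
def tau1Sym (η : ℝ) (M : ℕ) (p' : Fin d → ℝ) (μ ν l κ : Fin d) : ℂ :=
  (1 / 2 : ℂ) * ∑ m ∈ lShifts d M, tau1Term η (shiftMom p' m) μ ν l κ

/-- **(7.1.16)** p. 323 [PDF 25], verbatim: *"In the formula for τ₂, the averaging only occurs in a_μ(p′) = ∂^{(1)}_μ(p′)Σ_l
(|u/v_μ|²(1/Δ))(p′+l). (7.1.16)"* [cite: BalabanImbrieJaffe1985, (7.1.16) p.323] -/
def aSym (η : ℝ) (M : ℕ) (p' : Fin d → ℝ) (μ : Fin d) : ℂ :=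
  dOne p' μ * ∑ m ∈ lShifts d M,
    (((‖uSym η (shiftMom p' m) / vSym η (shiftMom p' m) μ‖ ^ 2 * (lapSym η (shiftMom p' m))⁻¹ : ℝ)) : ℂ)

/-- **(7.1.15)** p. 323 [PDF 25], verbatim: *"τ_{2,μνλκ}(p′) = (a_μ\bar{a}_λ(φ_νφ_κ)^{−1/2}[δ_{νκ} − (∂^{(1)}_ν\bar{∂^{(1)}_κ}/√(φ_νφ_κ))
(Σ_ρ|∂^{(1)}_ρ|²/φ_ρ)^{−1}])(p′). (7.1.15)"* — over `aSym` (7.1.16) and `phiSym` (7.1.10). [cite: BalabanImbrieJaffe1985, (7.1.15) p.323] -/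
def tau2Sym (η : ℝ) (M : ℕ) (p' : Fin d → ℝ) (μ ν l κ : Fin d) : ℂ :=
  aSym η M p' μ * conj (aSym η M p' l) * (((phiSym η M p' ν * phiSym η M p' κ) ^ (-(1 / 2 : ℝ)) : ℝ) : ℂ) *
    ((if ν = κ then 1 else 0) -
      dOne p' ν * conj (dOne p' κ) / ((Real.sqrt (phiSym η M p' ν * phiSym η M p' κ) : ℝ) : ℂ) *
        (((∑ ρ : Fin d, ‖dOne p' ρ‖ ^ 2 / phiSym η M p' ρ : ℝ) : ℂ))⁻¹)

/-- **(7.1.13)** p. 322 [PDF 24], verbatim: *"Starting from this expression, one can derive the following formulas for σ_k(p) by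
straightforward, algebraic manipulation: We express σ_k as a sum of two terms σ_k = τ₁ + τ₂. (7.1.13)"* — as a statement
about the symbol `σ` of σ_k (componentwise; the derivation from [6 I, (1.83)–(1.84)] is not reproduced).
[cite: BalabanImbrieJaffe1985, (7.1.13) p.322] -/
def Eq7113 (η : ℝ) (M : ℕ) (σ : (Fin d → ℝ) → Fin d → Fin d → Fin d → Fin d → ℂ) : Prop :=
  ∀ (p' : Fin d → ℝ) (μ ν l κ : Fin d), σ p' μ ν l κ = tau1Sym η M p' μ ν l κ + tau2Sym η M p' μ ν l κ

/-- The Fourier components of a unit-lattice curl f = ∂B at momentum p′: f̃_{λκ} = ∂^{(1)}_λ(p′)B̃_κ − ∂^{(1)}_κ(p′)B̃_λ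
(*"τ₁ vanishes on curls. Thus if f = ∂B, then τ₁f = 0"*, p. 322). [cite: BalabanImbrieJaffe1985, (7.1.13) p.322] -/
def curlOne (p' : Fin d → ℝ) (B : Fin d → ℂ) (l κ : Fin d) : ℂ := dOne p' l * B κ - dOne p' κ * B l

/-- kernel: ∂^{(1)} is 2π-periodic, ∂^{(1)}(p′ + l) = ∂^{(1)}(p′) for l ∈ 2πZ^d. [cite: BalabanImbrieJaffe1985, (7.1.8) p.322] -/
theorem dOne_shiftMom (p' : Fin d → ℝ) (m : Fin d → ℤ) (μ : Fin d) : dOne (shiftMom p' m) μ = dOne p' μ := by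
  rw [dOne, dOne, shiftMom]
  congr 1
  have h : Complex.I * (((p' μ + 2 * π * (m μ : ℝ) : ℝ)) : ℂ) = Complex.I * ((p' μ : ℝ) : ℂ) + (m μ : ℤ) * (2 * π * Complex.I) := by
    push_cast
    ring
  rw [h, Complex.exp_add, Complex.exp_int_mul_two_pi_mul_I, mul_one]

/-- kernel: at a momentum q with ∂^{(1)}(q) = ∂^{(1)}(p′) (q = p′ + l, `dOne_shiftMom`), dividing a unit-lattice curl by
v_λ(q)v_κ(q) turns it into a curl for ∂(q): f̃_{λκ}/(v_λv_κ) = ∂_λ(q)(B̃_κ/v_κ) − ∂_κ(q)(B̃_λ/v_λ) — the momentum-space form of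
"Q^{e*}_k∂ = ∂Q^{s*}_k" (p. 323); generic momenta (`hp`, `hq`). [cite: BalabanImbrieJaffe1985, (7.1.18) p.323] -/
theorem curlOne_div_vSym (η : ℝ) (p' q : Fin d → ℝ) (hper : ∀ i : Fin d, dOne q i = dOne p' i)
    (hp : ∀ i : Fin d, dOne p' i ≠ 0) (hq : ∀ i : Fin d, dSym η q i ≠ 0) (B : Fin d → ℂ) (l κ : Fin d) :
    curlOne p' B l κ / (vSym η q l * vSym η q κ) =
      dSym η q l * (B κ / vSym η q κ) - dSym η q κ * (B l / vSym η q l) := by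
  simp only [curlOne, vSym_eq, hper]
  have h1 := hp l
  have h2 := hp κ
  have h3 := hq l
  have h4 := hq κ
  field_simp

/-- **(7.1.13)/(7.1.18)** p. 322–323: *"Here τ₁ vanishes on curls. Thus if f = ∂B, then τ₁f = 0."* — PROVED for each term
of (7.1.14): at a momentum q with ∂^{(1)}(q) = ∂^{(1)}(p′) (every q = p′ + l), Σ_{λ,κ}(|u|²/(\bar{v}_μ\bar{v}_νv_λv_κ)
P_{μλ}P_{νκ})(q)·f̃_{λκ} = 0 for the curl components f̃ = `curlOne p′ B` (generic momenta: Δ(q) ≠ 0, ∂^{(1)}(p′) and ∂(q)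
componentwise ≠ 0). [cite: BalabanImbrieJaffe1985, (7.1.18) p.323] -/
theorem tau1Term_curl (η : ℝ) (p' q : Fin d → ℝ) (hper : ∀ i : Fin d, dOne q i = dOne p' i) (hΔ : lapSym η q ≠ 0)
    (hp : ∀ i : Fin d, dOne p' i ≠ 0) (hq : ∀ i : Fin d, dSym η q i ≠ 0) (B : Fin d → ℂ) (μ ν : Fin d) :
    ∑ l : Fin d, ∑ κ : Fin d, tau1Term η q μ ν l κ * curlOne p' B l κ = 0 := by
  have hv : ∀ i : Fin d, vSym η q i ≠ 0 := fun i => by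
    rw [vSym_eq, hper]
    exact div_ne_zero (hp i) (hq i)
  -- factor the λ,κ-independent prefactor and convert the curl
  have hfac : ∀ l κ : Fin d, tau1Term η q μ ν l κ * curlOne p' B l κ =
      (((‖uSym η q‖ ^ 2 : ℝ) : ℂ) / (conj (vSym η q μ) * conj (vSym η q ν))) *
        (projSym η q μ l * projSym η q ν κ * (curlOne p' B l κ / (vSym η q l * vSym η q κ))) := by
    intro l κ
    rw [tau1Term]
    have := hv l
    have := hv κ
    field_simp
  simp_rw [hfac, curlOne_div_vSym η p' q hper hp hq, ← Finset.mul_sum]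
  -- Σ_λ Σ_κ P_{μλ}P_{νκ}(∂_λ w_κ − ∂_κ w_λ) = (P∂)_μ (Pw)_ν − (Pw)_μ (P∂)_ν = 0
  have hsplit : ∑ l : Fin d, ∑ κ : Fin d, projSym η q μ l * projSym η q ν κ *
      (dSym η q l * (B κ / vSym η q κ) - dSym η q κ * (B l / vSym η q l)) =
      (∑ l : Fin d, projSym η q μ l * dSym η q l) * (∑ κ : Fin d, projSym η q ν κ * (B κ / vSym η q κ)) -
        (∑ l : Fin d, projSym η q μ l * (B l / vSym η q l)) * (∑ κ : Fin d, projSym η q ν κ * dSym η q κ) := by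
    rw [Finset.sum_mul_sum, Finset.sum_mul_sum, ← Finset.sum_sub_distrib]
    refine Finset.sum_congr rfl fun l _ => ?_
    rw [← Finset.sum_sub_distrib]
    exact Finset.sum_congr rfl fun κ _ => by ring
  rw [hsplit, projSym_dSym hΔ μ, projSym_dSym hΔ ν, zero_mul, mul_zero, sub_zero, mul_zero]

/-- **(7.1.18)** in momentum space: the full τ₁(p′) of (7.1.14) kills unit-lattice curls, Σ_{λ,κ}τ_{1,μνλκ}(p′)f̃_{λκ} = 0 for
f = ∂B (generic momenta at every p′ + l of the sum). [cite: BalabanImbrieJaffe1985, (7.1.18) p.323] -/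
theorem tau1Sym_curl (η : ℝ) (M : ℕ) (p' : Fin d → ℝ) (hp : ∀ i : Fin d, dOne p' i ≠ 0)
    (hΔ : ∀ m ∈ lShifts d M, lapSym η (shiftMom p' m) ≠ 0)
    (hq : ∀ m ∈ lShifts d M, ∀ i : Fin d, dSym η (shiftMom p' m) i ≠ 0) (B : Fin d → ℂ) (μ ν : Fin d) :
    ∑ l : Fin d, ∑ κ : Fin d, tau1Sym η M p' μ ν l κ * curlOne p' B l κ = 0 := by
  simp only [tau1Sym, Finset.mul_sum, Finset.sum_mul]
  calc ∑ l : Fin d, ∑ κ : Fin d, ∑ m ∈ lShifts d M, 1 / 2 * tau1Term η (shiftMom p' m) μ ν l κ * curlOne p' B l κ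
      = ∑ l : Fin d, ∑ m ∈ lShifts d M, ∑ κ : Fin d, 1 / 2 * tau1Term η (shiftMom p' m) μ ν l κ * curlOne p' B l κ :=
        Finset.sum_congr rfl fun l _ => Finset.sum_comm
    _ = ∑ m ∈ lShifts d M, ∑ l : Fin d, ∑ κ : Fin d, 1 / 2 * tau1Term η (shiftMom p' m) μ ν l κ * curlOne p' B l κ :=
        Finset.sum_comm
    _ = ∑ m ∈ lShifts d M, 1 / 2 * ∑ l : Fin d, ∑ κ : Fin d, tau1Term η (shiftMom p' m) μ ν l κ * curlOne p' B l κ := by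
        refine Finset.sum_congr rfl fun m _ => ?_
        rw [Finset.mul_sum]
        refine Finset.sum_congr rfl fun l _ => ?_
        rw [Finset.mul_sum]
        exact Finset.sum_congr rfl fun κ _ => by ring
    _ = 0 := Finset.sum_eq_zero fun m hm => by
        rw [tau1Term_curl η p' (shiftMom p' m) (dOne_shiftMom p' m) (hΔ m hm) hp (hq m hm) B μ ν, mul_zero]

/-- **(7.1.17)–(7.1.18)** p. 323 [PDF 25], verbatim: *"The general form of τ₁ in configuration space is evident from (7.1.11),
(7.1.14) namely τ₁ = Q^e_k(I − P_∂)Q^{e*}_k, (7.1.17) where P_∂ denotes the orthogonal projection onto curls. … Furthermore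
Q^{e*}_k∂ = ∂Q^{s*}_k, so τ₁∂ = Q^e_k(I − P_∂)∂Q^{s*}_k = 0. (7.1.18)"* — PROVED as operator algebra: for linear maps with
P_∂∂ = ∂ (`hP`) and Q^{e*}_k∂ = ∂Q^{s*}_k (`hQ`), (Q^e_k(I − P_∂)Q^{e*}_k)∂ = 0. [cite: BalabanImbrieJaffe1985, (7.1.18) p.323] -/
theorem eq7118 {R : Type*} [CommSemiring R] {A1 F1 Fη Aη : Type*} [AddCommGroup A1] [Module R A1] [AddCommGroup F1]
    [Module R F1] [AddCommGroup Fη] [Module R Fη] [AddCommGroup Aη] [Module R Aη]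
    (Qe : Fη →ₗ[R] F1) (Qes : F1 →ₗ[R] Fη) (Qss : A1 →ₗ[R] Aη) (d1 : A1 →ₗ[R] F1) (dη : Aη →ₗ[R] Fη) (P : Fη →ₗ[R] Fη)
    (hP : P ∘ₗ dη = dη) (hQ : Qes ∘ₗ d1 = dη ∘ₗ Qss) :
    (Qe ∘ₗ (LinearMap.id - P) ∘ₗ Qes) ∘ₗ d1 = 0 := by
  ext B
  have h1 : Qes (d1 B) = dη (Qss B) := by simpa using LinearMap.congr_fun hQ B
  have h2 : P (dη (Qss B)) = dη (Qss B) := by simpa using LinearMap.congr_fun hP (Qss B)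
  simp [h1, h2]

end

end Literature.MathematicalPhysics.QuantumFieldTheory.BalabanImbrieJaffe1984to88.BIJ85MomentumSymbols71
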